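import Mathlib
import Summits.Ventures.PercRepro2.TypedPendantA3AtO

/-!
# The pendant `a₃` at `o`, weighted: `Gc(p) = (1 − p_f) · Gc(p[f := 0])` (blind cell PercRepro2,
mine-2 g54, 2026-08-29; `conjectures/MINE-2.md` M2-114 add. 1)

The typed rule `typedCount_pendant_a3_at_o` (`TypedPendantA3AtO.lean`: at a pendant `a₃`
attached at the mark `o` by the edge `f`, the typed base of class `k` is `C(2, k)` times the base
with `a₃` isolated) lifts to every weight vector through p1's pinning recursion `triSum_pin`: for
`f ∉ F`,

  **`triSum_pendant_a3_at_o`**: `triSum p F τ K₃ = (1 − p f) · triSum (p[f := 0]) F τ K₃`.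

The base case (every free edge other than `f` pinned) is the typed rule read through
`triSum_pinned_eq` — the four pieces of the recursion at `f` carry the Bernstein weights
`(1 − t)³, t(1 − t)², t²(1 − t), t³` and the typed bases `N₀, 2N₀, N₀, 0`, and
`(1 − t)³ + 2t(1 − t)² + t²(1 − t) = 1 − t`; the induction on the number of fractional free edges
is the one of `triSum_nonneg_of_pinned`, with the recursion at a fractional edge `e ≠ f` applied
to both sides.  With `F = ∅` this is the cubic form of the covariance form (HCOV)
(`hcov_cubic`): **`Gc_pendant_a3_at_o`**: `Gc p = (1 − p f) · Gc (p[f := 0])` — the weighted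
row «`a₃` at `o`: `(1 − t) · I`» of `conjectures/MINE-2-RULES.md` (Thm 21, there on `K₅`) holds on
every finite graph — and **`HCov_pendant_a3_at_o`**: (HCOV) at a pendant `a₃` at `o` follows
from (HCOV) on the instance with the leaf edge removed.  Own work; standard axioms.
-/

namespace Summit.Ventures.PercRepro2

namespace CovForm

namespace TypedRed

open OneTyped

section Weighted

open Classical

variable {V : Type*} {E : Type*} [Fintype E] [DecidableEq E] {R : Type*} [Field R]
variable (ends : E → Sym2 V) (o a₁ a₂ a₃ b : V)

omit [Fintype E] in
/-- Pinning an edge closed in the weights pins it closed in the pinned configuration. -/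
lemma pinnedConfig_update_zero (p : E → R) (f : E) :
    pinnedConfig (Function.update p f 0) = Function.update (pinnedConfig p) f false := by
  funext e
  by_cases h : e = f
  · subst h
    simp [pinnedConfig]
  · unfold pinnedConfig
    rw [Function.update_of_ne h, Function.update_of_ne h]

omit [Fintype E] in
/-- Pinning an edge open in the weights pins it open in the pinned configuration. -/
lemma pinnedConfig_update_one (p : E → R) (f : E) :
    pinnedConfig (Function.update p f 1) = Function.update (pinnedConfig p) f true := by
  funext e
  by_cases h : e = f
  · subst h
    simp [pinnedConfig]
  · unfold pinnedConfig
    rw [Function.update_of_ne h, Function.update_of_ne h]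

/-- **The base case**: every free edge other than `f` pinned. -/
lemma triSum_pendant_a3_at_o_pinned {f : E} (hf : ends f = s(a₃, o))
    (hleaf : ∀ e, a₃ ∈ ends e → e = f) (h3o : a₃ ≠ o) (h31 : a₃ ≠ a₁) (h32 : a₃ ≠ a₂)
    (h3b : a₃ ≠ b) (p : E → R) (F : Finset E) (hfF : f ∉ F)
    (hq : ∀ e, e ∉ insert f F → p e = 0 ∨ p e = 1) (τ : E → ℕ) :
    triSum p F τ (K3 ends o a₁ a₂ a₃ b : Config E → Config E → Config E → R) =
      (1 - p f) * triSum (Function.update p f 0) F τ (K3 ends o a₁ a₂ a₃ b) := by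
  have hfF' : f ∈ insert f F := Finset.mem_insert_self f F
  have hne : ∀ e ∈ F, e ≠ f := fun e he => ne_of_mem_of_not_mem he hfF
  have hq0 : ∀ e, e ∉ F → Function.update p f 0 e = 0 ∨ Function.update p f 0 e = 1 := by
    intro e he
    by_cases h : e = f
    · subst h; left; simp
    · rw [Function.update_of_ne h]
      exact hq e (by simp [he, h])
  have hq1 : ∀ e, e ∉ F → Function.update p f 1 e = 0 ∨ Function.update p f 1 e = 1 := by
    intro e he
    by_cases h : e = f
    · subst h; right; simp
    · rw [Function.update_of_ne h]
      exact hq e (by simp [he, h])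
  -- the common product over `F`
  set P0 : R := ∏ e ∈ F, p e ^ τ e * (1 - p e) ^ (3 - τ e) with hP0
  have hprod : ∀ k : ℕ, (∏ e ∈ F, p e ^ Function.update τ f k e *
      (1 - p e) ^ (3 - Function.update τ f k e)) = P0 := fun k =>
    Finset.prod_congr rfl fun e he => by rw [Function.update_of_ne (hne e he)]
  have hprod0 : (∏ e ∈ F, Function.update p f 0 e ^ τ e *
      (1 - Function.update p f 0 e) ^ (3 - τ e)) = P0 :=
    Finset.prod_congr rfl fun e he => by rw [Function.update_of_ne (hne e he)]
  have hprod1 : (∏ e ∈ F, Function.update p f 1 e ^ τ e *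
      (1 - Function.update p f 1 e) ^ (3 - τ e)) = P0 :=
    Finset.prod_congr rfl fun e he => by rw [Function.update_of_ne (hne e he)]
  -- the common typed base `N₀`
  set T₀ : R := typedCount F (Function.update (pinnedConfig p) f false) τ
    (K3 ends o a₁ a₂ a₃ b) with hT₀
  have hT0 : typedCount (insert f F) (pinnedConfig p) (Function.update τ f 0)
      (K3 ends o a₁ a₂ a₃ b : Config E → Config E → Config E → R) = T₀ := by
    rw [typedCount_type_zero (insert f F) f hfF' _ _ (Function.update_self f 0 τ),
      Finset.erase_insert hfF, hT₀]
    exact typedCount_congr_τ _ _ (fun e he => Function.update_of_ne (hne e he) _ _) _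
  have hT3 : typedCount F (Function.update (pinnedConfig p) f true) τ
      (K3 ends o a₁ a₂ a₃ b : Config E → Config E → Config E → R) = 0 := by
    have h := typedCount_type_three (insert f F) f hfF' (pinnedConfig p) (Function.update τ f 3)
      (Function.update_self f 3 τ) (K3 ends o a₁ a₂ a₃ b : Config E → Config E → Config E → R)
    rw [Finset.erase_insert hfF,
      typedCount_congr_τ F _ (fun e he => Function.update_of_ne (hne e he) _ _) _] at h
    rw [← h, typedCount_pendant_a3_at_o ends o a₁ a₂ a₃ b hf hleaf h3o h31 h32 h3b (insert f F)
      hfF' (pinnedConfig p) τ 3, Nat.choose_eq_zero_of_lt (by norm_num), Nat.cast_zero, zero_mul]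
  have hT1 := typedCount_pendant_a3_at_o (R := R) ends o a₁ a₂ a₃ b hf hleaf h3o h31 h32 h3b
    (insert f F) hfF' (pinnedConfig p) τ 1
  have hT2 := typedCount_pendant_a3_at_o (R := R) ends o a₁ a₂ a₃ b hf hleaf h3o h31 h32 h3b
    (insert f F) hfF' (pinnedConfig p) τ 2
  rw [hT0] at hT1 hT2
  rw [triSum_pin p hfF τ, triSum_pinned_eq p (insert f F) hq, triSum_pinned_eq p (insert f F) hq,
    triSum_pinned_eq _ F hq0, triSum_pinned_eq _ F hq1, Finset.prod_insert hfF,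
    Finset.prod_insert hfF, hprod, hprod, hprod0, hprod1, pinnedConfig_update_zero,
    pinnedConfig_update_one, hT1, hT2, hT3, ← hT₀, Function.update_self, Function.update_self]
  simp only [Nat.choose_one_right, Nat.choose_self, Nat.cast_ofNat, Nat.cast_one]
  ring

/-- **The weighted pendant `a₃` at `o`**: for a typed edge set `F` not containing the leaf edge
`f = {a₃, o}` (`a₃` a leaf carrying exactly the mark `a₃`, distinct from `o, a₁, a₂, b`), every
typed three-copy sum of `K₃` is `(1 − p f)` times the sum with `f` pinned closed — for every weight
vector `p` and every type vector `τ`. -/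
theorem triSum_pendant_a3_at_o {f : E} (hf : ends f = s(a₃, o))
    (hleaf : ∀ e, a₃ ∈ ends e → e = f) (h3o : a₃ ≠ o) (h31 : a₃ ≠ a₁) (h32 : a₃ ≠ a₂)
    (h3b : a₃ ≠ b) (p : E → R) (F : Finset E) (hfF : f ∉ F) (τ : E → ℕ) :
    triSum p F τ (K3 ends o a₁ a₂ a₃ b : Config E → Config E → Config E → R) =
      (1 - p f) * triSum (Function.update p f 0) F τ (K3 ends o a₁ a₂ a₃ b) := by
  generalize hn : (triFracFree p (insert f F)).card = n
  induction n using Nat.strong_induction_on generalizing p F τ with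
  | _ n ih =>
    by_cases h0 : triFracFree p (insert f F) = ∅
    · apply triSum_pendant_a3_at_o_pinned ends o a₁ a₂ a₃ b hf hleaf h3o h31 h32 h3b p F hfF _ τ
      intro e he
      by_contra hc
      rw [not_or] at hc
      have : e ∈ triFracFree p (insert f F) := mem_triFracFree.mpr ⟨he, hc.1, hc.2⟩
      rw [h0] at this
      exact absurd this (Finset.notMem_empty e)
    · obtain ⟨e, he⟩ := Finset.nonempty_iff_ne_empty.mpr h0
      have heF : e ∉ insert f F := (mem_triFracFree.mp he).1
      have hef : e ≠ f := fun h => heF (h ▸ Finset.mem_insert_self f F)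
      have heF' : e ∉ F := fun h => heF (Finset.mem_insert_of_mem h)
      have hfF' : f ∉ insert e F := by
        rw [Finset.mem_insert, not_or]
        exact ⟨hef.symm, hfF⟩
      have hlt : ((triFracFree p (insert f F)).erase e).card < n := by
        rw [← hn]
        exact Finset.card_erase_lt_of_mem he
      have hc0 : (triFracFree (Function.update p e 0) (insert f F)).card =
          ((triFracFree p (insert f F)).erase e).card := by
        rw [triFracFree_update p (insert f F) e 0 (Or.inl rfl)]
      have hc1 : (triFracFree (Function.update p e 1) (insert f F)).card =
          ((triFracFree p (insert f F)).erase e).card := by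
        rw [triFracFree_update p (insert f F) e 1 (Or.inr rfl)]
      have hc2 : (triFracFree p (insert f (insert e F))).card =
          ((triFracFree p (insert f F)).erase e).card := by
        rw [Finset.insert_comm, triFracFree_insert]
      have h1 := ih _ hlt (Function.update p e 0) F hfF τ hc0
      have h2 := ih _ hlt (Function.update p e 1) F hfF τ hc1
      have h3 := ih _ hlt p (insert e F) hfF' (Function.update τ e 1) hc2
      have h4 := ih _ hlt p (insert e F) hfF' (Function.update τ e 2) hc2
      rw [triSum_pin p heF' τ, triSum_pin (Function.update p f 0) heF' τ, h1, h2, h3, h4,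
        Function.update_of_ne hef.symm, Function.update_of_ne hef.symm, Function.update_of_ne hef,
        Function.update_comm hef, Function.update_comm hef]
      ring

variable [LinearOrder R] [IsStrictOrderedRing R]

/-- **(HCOV)'s cubic form at a pendant `a₃` at `o`**: `Gc p = (1 − p f) · Gc (p[f := 0])`. -/
theorem Gc_pendant_a3_at_o {f : E} (hf : ends f = s(a₃, o))
    (hleaf : ∀ e, a₃ ∈ ends e → e = f) (h3o : a₃ ≠ o) (h31 : a₃ ≠ a₁) (h32 : a₃ ≠ a₂)
    (h3b : a₃ ≠ b) (p : E → R) :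
    Gc p ends o a₁ a₂ a₃ b = (1 - p f) * Gc (Function.update p f 0) ends o a₁ a₂ a₃ b := by
  rw [hcov_cubic p ends o a₁ a₂ a₃ b (fun _ => 0),
    hcov_cubic (Function.update p f 0) ends o a₁ a₂ a₃ b (fun _ => 0)]
  exact triSum_pendant_a3_at_o ends o a₁ a₂ a₃ b hf hleaf h3o h31 h32 h3b p ∅
    (Finset.notMem_empty f) (fun _ => 0)

/-- **(HCOV) at a pendant `a₃` at `o`** follows from (HCOV) with the leaf edge pinned closed
(`a₃` isolated), for every weight `p f ≤ 1`. -/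
theorem HCov_pendant_a3_at_o {f : E} (hf : ends f = s(a₃, o))
    (hleaf : ∀ e, a₃ ∈ ends e → e = f) (h3o : a₃ ≠ o) (h31 : a₃ ≠ a₁) (h32 : a₃ ≠ a₂)
    (h3b : a₃ ≠ b) (p : E → R) (hp : p f ≤ 1)
    (h : HCov (Function.update p f 0) ends o a₁ a₂ a₃ b) : HCov p ends o a₁ a₂ a₃ b := by
  unfold HCov at h ⊢
  rw [Gc_pendant_a3_at_o ends o a₁ a₂ a₃ b hf hleaf h3o h31 h32 h3b p]
  exact mul_nonneg (sub_nonneg.mpr hp) h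

end Weighted

end TypedRed

end CovForm

end Summit.Ventures.PercRepro2
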